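import Summits.QuantumFields.BalabanUV.Beta.GAN24.CombBornLambdaLineage
import Summits.QuantumFields.BalabanUV.Beta.GAN24.BornLambdaContactCells
import Summits.QuantumFields.BalabanUV.Beta.SymAveragingHessianCounts

/-!
# `BalabanUV.Beta.GAN24.CombBornLambdaContactCells` — binder row G-an2-4 ∕ (CONV-C), TRANSFER-III, the (III′) S-slot (b) of the END, born-Λ contact letter `hCg` (road-P2 M.104's
# 3rd hypothesis), LEG∕TABLE JUNCTION: **THE BORN Λ-PIECES OF `combFreshAt tabs 0 cΛ i` AT an1's RECORD `tabs.H = symHessFFAt ρ_t Lc`, IN UNITS, ARE ONE Λ-PIECE EACH (the (E)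
# coefficient families VERBATIM) AND ARE TRANSVERSAL** — the twin of leaf-01 g59's (E) `BornLambdaContactCells` §1 (`unitS_freshAt_lam_zero∕succ_eq_SLam`, `divV_bornLam_zero∕succ_eq_zero`)
# over road-P2 M.58 `CombBornLambdaLineage.unitS_combFreshAt_lam_zero∕succ` and an1's `biLoc_symHessFFAt` BY NAME (an2's `divV_SLam_lamCoeffOf_eq_zero` ∕ `divV_SLam_lamCoeffK_E2_eq_zero` are
# generic in the vertex family); the coefficient-decay letters are (E)'s, table-free (`exists_abs_bornLamCoeff_zero_le`, `abs_bornLamCoeff_succ_le_of_unitDecayK`)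
# (G-an2-4 CRUX TEAM (2), leaf prover `b2b-balaban-gan24-formalise-leaf-01`, gen 90)

WHAT IS PROVED (generic `d`; [folklore]): `unitS_combFreshAt_lam_zero_eq_SLam`, `unitS_combFreshAt_lam_succ_eq_SLam` (for `tabs.H = symHessFFAt ρ Lc`, every `ρ`),
`divV_combBornLam_zero_eq_zero`, `divV_combBornLam_succ_eq_zero` (box root).
NOT HERE: the count (`CombBornLambdaContactLineage`), the letters and the END (`CombBornLambdaContactBound`).

NOT IN PRINT; OUR BOOKKEEPING ([folklore]; 0 `def`, 0 cited fact, 0 `def … : Prop`, 0 sorry).  HONEST FRAMING (cell contract, verbatim): «discharging `BetaPertH` makes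
Bałaban's UV stability UNCONDITIONAL — a real constructive-QFT result; it is NOT the continuum limit and NOT the Clay problem.»  HONEST DEPENDENCY (verbatim): «continuum YM
on T⁴ ⇐ BetaPertH ∧ nine spine estimates (0/9 proved); BetaPertH ⇐ (D1) ∧ (D4) ∧ CAP+tail; G-an2-4 gates asym, D1 and NE2/3/4.»  Discharges NO letter of M.104 by itself;
NEVER «G-an2-4 closed» as (CONV-C); NOT D1, NOT `BetaPertH`, NOT continuum, NOT Clay.  2026-08-28; no existing file touched.
-/

noncomputable section

open Finset
open scoped BigOperators
open Literature.MathematicalPhysics.QuantumFieldTheory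
open Literature.MathematicalPhysics.QuantumFieldTheory.Balaban1983to89
open Literature.MathematicalPhysics.QuantumFieldTheory.Balaban1983to89.Beta
open ExpKernelCalculus (MKer Decays VertexFamily)
open AffineAveraging (Site box toSite)
open AveragingHessianKernels (ell)
open OneStepResolventKernel (Fib KInv decays_KInv)
open BalabanStepJetsSucc (E2 lamCoeffK)
open BalabanStepJets (lamCoeffOf)
open InterLevelTransport (SLam)
open KernelWard (divV)
open Summit.QuantumFields.BalabanUV.Beta.HessKerDressedUnits (unitS)
open Summit.QuantumFields.BalabanUV.Beta.SymAveragingHessianCounts (symHessFFAt biLoc_symHessFFAt)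
open Summit.QuantumFields.BalabanUV.Beta.SymmetrisedStepJets (SymTables)
open Summit.QuantumFields.BalabanUV.Beta.WardLocusStencils (divV_SLam_lamCoeffOf_eq_zero)
open Summit.QuantumFields.BalabanUV.Beta.MixedWardPackingFF (divV_smul)
open Summit.QuantumFields.BalabanUV.Beta.WardLocusStep (divV_SLam_lamCoeffK_E2_eq_zero)
open Summit.QuantumFields.BalabanUV.Beta.GAN24.CombesThomas (sfStep smStep KStepUnit)
open Summit.QuantumFields.BalabanUV.Beta.GAN24.StencilSlotLam (SLam_smul)
open Summit.QuantumFields.BalabanUV.Beta.GAN24.Push4 (IsFF)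
open Summit.QuantumFields.BalabanUV.Beta.GAN24.CombBornSector (combFreshAt)
open Summit.QuantumFields.BalabanUV.Beta.GAN24.CombBornLambdaLineage (unitS_combFreshAt_lam_zero unitS_combFreshAt_lam_succ)
open Summit.QuantumFields.BalabanUV.Beta.GAN24.BornLambdaContactCells (lamCoeffK_smul_right exists_decays_KStepUnit)

namespace Summit.QuantumFields.BalabanUV.Beta.GAN24.CombBornLambdaContactCells

variable {d : ℕ} {Lc : ℕ} [NeZero Lc] (tabs : SymTables d Lc)

/-! ## §1 The born Λ-pieces of `combFreshAt` at the sym Hessian record, in units, as one Λ-piece each -/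

/-- [folklore] **THE BORN Λ-PIECE OF MEMBER `0` IN UNITS AS ONE Λ-PIECE AT THE SYM TABLE** (road-P2's `unitS_combFreshAt_lam_zero` + the OWNER's `SLam_smul`; the scalar `cΛ`
absorbed into the (E) coefficient family `cΛ·lamCoeffOf (KInv Lc) Lc`). -/
theorem unitS_combFreshAt_lam_zero_eq_SLam {ρ : Fin (d + 1) → ℤ} (hH : tabs.H = symHessFFAt ρ Lc) (cΛ : ℝ) :
    unitS (sfStep Lc 0) (smStep d Lc 0) (combFreshAt tabs 0 cΛ 0)
      = SLam Lc (fun μ y κ u => cΛ * lamCoeffOf (KInv (N := Lc) (d := d)) Lc μ y κ u) (fun μ y => symHessFFAt ρ Lc μ y) := by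
  rw [unitS_combFreshAt_lam_zero, SLam_smul, hH]

/-- [folklore] **THE BORN Λ-PIECE OF MEMBER `j+1` IN UNITS AS ONE Λ-PIECE AT THE SYM TABLE** (road-P2's `unitS_combFreshAt_lam_succ` — the table is ff-valued — + `SLam_smul`; the
`j`-free weight `cΛ·Lc^{2(d+1)}` absorbed into the (E) coefficient family). -/
theorem unitS_combFreshAt_lam_succ_eq_SLam (hHff : ∀ μ y, IsFF (tabs.H μ y)) {ρ : Fin (d + 1) → ℤ} (hH : tabs.H = symHessFFAt ρ Lc) (cΛ : ℝ) (j : ℕ) :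
    unitS (sfStep Lc (j + 1)) (smStep d Lc (j + 1)) (combFreshAt tabs 0 cΛ (j + 1))
      = SLam Lc (fun μ y κ u => (cΛ * (Lc : ℝ) ^ (2 * (d + 1))) *
          lamCoeffK (KStepUnit (d := d) Lc (j + 1)) ((smStep d Lc j) ^ 2 • E2 d Lc (j + 1)) Lc μ y κ u) (fun μ y => symHessFFAt ρ Lc μ y) := by
  rw [unitS_combFreshAt_lam_succ tabs hHff, SLam_smul, hH]

/-! ## §2 Transversality at the sym Hessian record (box root) -/

/-- NOT IN PRINT; OUR BOOKKEEPING.  **THE BORN Λ-PIECE OF MEMBER `0` AT THE SYM TABLE IS TRANSVERSAL** (box root): an2's `WardLocusStencils.divV_SLam_lamCoeffOf_eq_zero` BY NAME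
(`decays_KInv`, an1's `biLoc_symHessFFAt` as the vertex family), through the scalar. -/
theorem divV_combBornLam_zero_eq_zero {rr : Fin (d + 1) → ℕ} (hrr : rr ∈ box (d + 1) Lc) (cΛ : ℝ) (u : Fin (d + 1) → ℤ) :
    divV (SLam Lc (fun μ y κ u => cΛ * lamCoeffOf (KInv (N := Lc) (d := d)) Lc μ y κ u) (fun μ y => symHessFFAt (toSite rr) Lc μ y)) u = 0 := by
  have hLc : 1 ≤ Lc := Nat.one_le_iff_ne_zero.2 (NeZero.ne Lc)
  obtain ⟨δ₀, C, hδ₀, hC, hdec⟩ := decays_KInv (N := Lc) (d := d)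
  have hQ : VertexFamily (fun μ y => symHessFFAt (toSite rr) Lc μ y) Lc
      (2 * (ell (d + 1) Lc : ℝ) ^ 2 * Real.exp (4 * ((d : ℝ) + 1) * Lc * δ₀)) δ₀ :=
    fun μ y => biLoc_symHessFFAt hLc μ y hrr hδ₀.le
  rw [SLam_smul, divV_smul, divV_SLam_lamCoeffOf_eq_zero hdec hC hδ₀ hQ u, smul_zero]

/-- NOT IN PRINT; OUR BOOKKEEPING.  **THE BORN Λ-PIECE OF MEMBER `j+1` AT THE SYM TABLE IS TRANSVERSAL** (box root): an2∕leaf-10's `WardLocusStep.divV_SLam_lamCoeffK_E2_eq_zero`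
BY NAME at the unit-normalised resolvent `KStepUnit Lc (j+1)` (`exists_decays_KStepUnit`), through the two scalars (`lamCoeffK_smul_right`, `SLam_smul`, `divV_smul`). -/
theorem divV_combBornLam_succ_eq_zero {rr : Fin (d + 1) → ℕ} (hrr : rr ∈ box (d + 1) Lc) (cΛ : ℝ) (j : ℕ) (u : Fin (d + 1) → ℤ) :
    divV (SLam Lc (fun μ y κ u => (cΛ * (Lc : ℝ) ^ (2 * (d + 1))) *
      lamCoeffK (KStepUnit (d := d) Lc (j + 1)) ((smStep d Lc j) ^ 2 • E2 d Lc (j + 1)) Lc μ y κ u) (fun μ y => symHessFFAt (toSite rr) Lc μ y)) u = 0 := by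
  have hLc : 1 ≤ Lc := Nat.one_le_iff_ne_zero.2 (NeZero.ne Lc)
  obtain ⟨CA, m, hm, hA⟩ := exists_decays_KStepUnit (d := d) (Lc := Lc) (j + 1)
  have hQ : VertexFamily (fun μ y => symHessFFAt (toSite rr) Lc μ y) Lc
      (2 * (ell (d + 1) Lc : ℝ) ^ 2 * Real.exp (4 * ((d : ℝ) + 1) * Lc * m)) m :=
    fun μ y => biLoc_symHessFFAt hLc μ y hrr hm.le
  have e : (fun μ y κ u => (cΛ * (Lc : ℝ) ^ (2 * (d + 1))) *
      lamCoeffK (KStepUnit (d := d) Lc (j + 1)) ((smStep d Lc j) ^ 2 • E2 d Lc (j + 1)) Lc μ y κ u)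
      = fun μ y κ u => (cΛ * (Lc : ℝ) ^ (2 * (d + 1)) * (smStep d Lc j) ^ 2) *
        lamCoeffK (KStepUnit (d := d) Lc (j + 1)) (E2 d Lc (j + 1)) Lc μ y κ u := by
    funext μ y κ u
    rw [lamCoeffK_smul_right]
    ring
  rw [e, SLam_smul, divV_smul, divV_SLam_lamCoeffK_E2_eq_zero (Lc := Lc) (j + 1) hA hm hQ hm u, smul_zero]

end Summit.QuantumFields.BalabanUV.Beta.GAN24.CombBornLambdaContactCells

end
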